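import Literature.Probability.RandomPlanarGeometry.SLEBubblesCloud
import Literature.Probability.RandomPlanarGeometry.RestrictionMeasuresExistence
import Literature.Probability.Process.PoissonCloudProofs
import HarnessLib

/-!
# The bubble cloud exists ([LSW] §7.2): discharge of `SLEBubbles.exists_cloud`; `P_α`, `α ≥ 5/8`, from Thm. 7.3 and the bubble measure alone

Proof-only file (no new definition, no new named fact), after

* G. F. Lawler, O. Schramm, W. Werner, *Conformal restriction: the chordal case*, J. Amer. Math.
  Soc. **16** (2003) 917–955, arXiv:math/0209343 (**[LSW]**), §7.2 (p. 28): "Consider a Poisson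
  point process `X` on `Ω_b × [0, ∞)` with mean (intensity) `λ μ × dt`"; Thm. 7.3 (p. 29); p. 5
  result 1 ("`P_α` exists if and only if `α ≥ 5/8`");
* J. F. C. Kingman, *Poisson Processes* (1993), §2.5, Existence Theorem.

`SLEBubblesCloud` reduced the named fact `SLEBubbles.exists_cloud` (`SLEBubbles`: for every
Brownian bubble measure `μ` and every `κ` some probability space carries a Poisson cloud with mean
measure `λ_κ μ ⊗ dt`) to Kingman's Existence Theorem
(`SLEBubbles.exists_cloud_of_exists_isPoissonCloud`), which is now a theorem of the tree
(`Literature.Probability.Process.exists_isPoissonCloud_holds`, `Process/PoissonCloudProofs`). Hence: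

* `SLEBubbles.exists_cloud_holds` — **the discharge** of `SLEBubbles.exists_cloud`;
* `exists_isRestrictionMeasure_of_five_eighths_le_of_thm73` — existence of `P_α` for every
  `α ≥ 5/8` (the "if" half of p. 5 result 1) from THREE named facts: a Brownian bubble measure
  exists (`exists_isBrownianBubbleMeasure`, §7.1) and Thm. 7.3 (`SLEBubbles.exists_measurable_version`,
  `SLEBubbles.measure_disjoint`);
* `exists_isRestrictionMeasure_iff_of_thm73_of_cor86`, `…_of_thm73_of_thm84` — p. 5 result 1
  (`exists_isRestrictionMeasure_iff`) from those three and Cor. 8.6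
  (`not_exists_isRestrictionMeasure_of_lt_five_eighths`), resp. from those three and the §8 leaves
  of Cor. 8.6 (`SLEKappaRho.exists_measurable_fill_version`, `SLEKappaRho.measure_fill_disjoint`,
  `SLEKappaRho.one_half_lt_measure_I_notMem_fill`) — six named facts in all.

The discharge cannot be appended to `SLEBubbles.lean` or `SLEBubblesCloud.lean` without importing
`Process/PoissonCloudProofs` there; a sibling keeps those files' import closure unchanged.
-/

noncomputable section

open MeasureTheory
open scoped NNReal
open Literature.Probability.Process (exists_isPoissonCloud exists_isPoissonCloud_holds)

namespace Literature.Probability.RandomPlanarGeometry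

/-- **The bubble cloud of [LSW] §7.2 exists** — discharge of the named fact
`SLEBubbles.exists_cloud`: for every Brownian bubble measure `μ` and every `κ` there is a
probability space carrying a Poisson cloud with mean measure `λ_κ μ ⊗ dt`, by Kingman's Existence
Theorem (`exists_isPoissonCloud_holds`) applied through
`SLEBubbles.exists_cloud_of_exists_isPoissonCloud` (measurable diagonal of `Ω_b × [0, ∞)`,
σ-finiteness of `μ`, no atoms — all proved in `SLEBubblesCloud`).
[cite: LawlerSchrammWerner2003Restriction, §7.2 (p. 28) with Kingman1993 §2.5] -/
theorem SLEBubbles.exists_cloud_holds : SLEBubbles.exists_cloud :=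
  SLEBubbles.exists_cloud_of_exists_isPoissonCloud exists_isPoissonCloud_holds

/-- **Existence of `P_α` for every `α ≥ 5/8` from Thm. 7.3 and the bubble measure** (the "if"
half of [LSW] p. 5 result 1): from `exists_isBrownianBubbleMeasure` (§7.1) and the two halves of
Thm. 7.3 (`h₁`: `Ω`-valued version of `Ξ(κ)`, `h₂`: avoidance formula (7.3), `0 < κ ≤ 8/3`), the
cloud being supplied by `SLEBubbles.exists_cloud_holds`.
[cite: LawlerSchrammWerner2003Restriction, Thm. 7.3 (p. 29) and p. 5 result 1] -/
theorem exists_isRestrictionMeasure_of_five_eighths_le_of_thm73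
    (hμex : exists_isBrownianBubbleMeasure)
    (h₁ : SLEBubbles.exists_measurable_version) (h₂ : SLEBubbles.measure_disjoint)
    {α : ℝ} (hα : 5 / 8 ≤ α) :
    ∃ P : Measure RestrictionConfig, IsRestrictionMeasure α P :=
  exists_isRestrictionMeasure_of_five_eighths_le_of_bubbles hμex SLEBubbles.exists_cloud_holds h₁ h₂ hα

/-- **[LSW] p. 5 result 1 from four named facts**: the bubble measure (§7.1), Thm. 7.3 (`h₁`,
`h₂`) and Cor. 8.6 (`h86`). [cite: LawlerSchrammWerner2003Restriction, p. 5 result 1; Thm. 7.3 (p. 29), Cor. 8.6 (p. 37)] -/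
theorem exists_isRestrictionMeasure_iff_of_thm73_of_cor86
    (hμex : exists_isBrownianBubbleMeasure)
    (h₁ : SLEBubbles.exists_measurable_version) (h₂ : SLEBubbles.measure_disjoint)
    (h86 : not_exists_isRestrictionMeasure_of_lt_five_eighths) : exists_isRestrictionMeasure_iff :=
  exists_isRestrictionMeasure_iff_of_bubbles hμex SLEBubbles.exists_cloud_holds h₁ h₂ h86

/-- **[LSW] p. 5 result 1 from six named facts**: the bubble measure (§7.1), Thm. 7.3 (`h₁`,
`h₂`), and from §8 the `Ω₊`-valued version of `F^{ℝ₊}_ℍ(cl K_∞)` for SLE(8/3, ρ) (`g₁`), Thm.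
8.4's avoidance formula (`g₂`) and the asymmetry of SLE(8/3, ρ), `ρ < 0` (`g₃`).
[cite: LawlerSchrammWerner2003Restriction, p. 5 result 1; Thm. 7.3 (p. 29), Thm. 8.4 and Cor. 8.6 (pp. 37–38)] -/
theorem exists_isRestrictionMeasure_iff_of_thm73_of_thm84
    (hμex : exists_isBrownianBubbleMeasure)
    (h₁ : SLEBubbles.exists_measurable_version) (h₂ : SLEBubbles.measure_disjoint)
    (g₁ : SLEKappaRho.exists_measurable_fill_version) (g₂ : SLEKappaRho.measure_fill_disjoint)
    (g₃ : SLEKappaRho.one_half_lt_measure_I_notMem_fill) : exists_isRestrictionMeasure_iff :=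
  exists_isRestrictionMeasure_iff_of_bubbles' hμex exists_isPoissonCloud_holds h₁ h₂ g₁ g₂ g₃

end Literature.Probability.RandomPlanarGeometry

end
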